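/-
Copyright (c) 2026. All rights reserved.
Released under Apache 2.0 license as described in the file LICENSE.
-/
import Mathlib
import HarnessLib
import Literature.MathematicalPhysics.QuantumLattice.AbelianFieldTensor
import Literature.MathematicalPhysics.QuantumLattice.AbelianMagneticFlux
import Literature.MathematicalPhysics.QuantumFieldTheory.U1WardIdentity
import Summits.Ventures.LatticeQCDFlow.Scaling.SectorActionFloor
import Summits.Ventures.LatticeQCDFlow.Scaling.TangentLineBudget
import Summits.Ventures.LatticeQCDFlow.Scaling.FluxInsertionMountainPass

/-!
# The mountain pass of a flux insertion on THREE plaquettes: the weighted tangent argument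
# (lean-1 GEN-7, own work)

HONEST FRAMING: exact (Metropolis-corrected) sampling algorithms for lattice gauge theory;
figures of merit are autocorrelation/cost numbers at stated couplings and volumes; no
continuum-physics claim.

Venture `LatticeQCDFlow` (cell pub-lqcd), topic `Scaling`, FANOUT row 30 (lean-1).  NEW WORK of the
cell; nothing here is cited as a fact; no `def`.  `d = 2`, compact `U(1)`, torus `(ℤ/L)²`.

`Scaling/FluxInsertionMountainPass{,Four}` prove the pointwise MOUNTAIN-PASS INEQUALITY
`max(S(U), S(WU)) ≥ N(1 − cos(α/2)) + M(1 − cos(π/M))` for an insertion `W` carrying angle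
`α = 2π/N` on `N ≥ 4` plaquettes: the actions before and after the insertion are EACH bounded below
by tangent lines of `1 − cos` at contact `α/2 = π/N`, which lie below `1 − cos` on the whole circle
only for contacts `≤ π/4`; and a wrapping plaquette is priced by `S(U) ≥ 2(1 + cos α)`.  At `N = 3`
(the wrapping-LINE insertion kernel at volume `L = 3`: `N = 3`, `M = 6`, contact `π/3`) BOTH steps
fail.  This file proves the `N = 3`, `M = 6` mountain pass by two replacements:
* (no wrap) bound the WEIGHTED combination `θ·S(U) + (1 − θ)·S(WU)`, `θ = ½ − √3/6`: per touched
  plaquette `θ(1 − cos F) + (1 − θ)(1 − cos(F + 2π/3)) = 1 − ½(cos u − sin u)` with `u = F + π/3`,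
  and `cos u − sin u = √2 cos(u + π/4) ≤ 1 − u` IS a whole-circle tangent bound, at contact `π/4`
  (theory2's `Trig.cos_le_tangent`, item 108); its slope `½ = sin(π/6)` equals the untouched
  plaquettes' tangent slope at contact `π/M = π/6`, so the flux quantisation `Σ F = 2πq` closes the
  bookkeeping exactly as in `mountainPass_arith` (`cos_sub_sin_le_one_sub`,
  `weighted_one_sub_cos_ge{,_neg}`, `weighted_tangent_le{,_neg}`);
* (a wrap) a plaquette that wraps costs `(1 − cos F) + (1 − cos F') ≥ 3 + cos α` on the two sides
  TOGETHER (`three_add_cos_le_of_jump_mul`, any `α ≤ π`), so two wraps force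
  `max ≥ (S(U) + S(WU))/2 ≥ 3 + cos α`, `= 5/2 ≥ 3(1 − cos(π/3)) + 6(1 − cos(π/6))` at `N = 3`.
Result: `threeSharpValue_le_max_wilsonAction_of_exp` — for an insertion with angle `2π/3` on `3`
positions and `0` on the other `6`, EVERY `U` whose charge it changes has
`max(S(U), S(WU)) ≥ 3(1 − cos(π/3)) + 6(1 − cos(π/6))`.  The line kernel at `L = 3` and the value of
its height at every `L ≥ 3` are in `Scaling/FluxInsertionLineHeightValueThree`.
No `def`, no `sorry`, standard axioms only.
-/

noncomputable section

open Real Set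
open Literature.MathematicalPhysics.QuantumFieldTheory Literature.MathematicalPhysics.QuantumLattice

namespace Summit.Ventures.LatticeQCDFlow.Theory2.Lattice.Flux

/-! ## §1 The weighted tangent bound at contact `π/3` -/

section Weighted

/-- `cos u − sin u ≤ 1 − u` whenever `u + π/4 ∈ [−π, π]`: the whole-circle tangent line of
`√2·cos` at contact `π/4`, shifted (`cos u − sin u = √2 cos(u + π/4)`). [folklore] -/
theorem cos_sub_sin_le_one_sub {u : ℝ} (h1 : -π ≤ u + π / 4) (h2 : u + π / 4 ≤ π) :
    Real.cos u - Real.sin u ≤ 1 - u := by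
  have key := Trig.cos_le_tangent (c := π / 4) (x := u + π / 4) (by positivity) le_rfl h1 h2
  rw [Real.cos_add, Real.cos_pi_div_four, Real.sin_pi_div_four] at key
  have hs : 0 < √2 / 2 := by positivity
  have h : (Real.cos u - Real.sin u) * (√2 / 2) ≤ (1 - u) * (√2 / 2) := by linarith [key]
  exact le_of_mul_le_mul_right h hs

/-- The weighted bound in the centred variable `u = F + π/3`:
`½ + ½u ≤ θ(1 − cos(u − π/3)) + (1 − θ)(1 − cos(u + π/3))`, `θ = ½ − √3/6`, whenever
`u + π/4 ∈ [−π, π]` (the combination equals `1 − ½(cos u − sin u)`). [folklore] -/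
theorem weighted_one_sub_cos_ge_aux {u : ℝ} (h1 : -π ≤ u + π / 4) (h2 : u + π / 4 ≤ π) :
    1 / 2 + 1 / 2 * u ≤
      (1 / 2 - √3 / 6) * (1 - Real.cos (u - π / 3)) +
        (1 - (1 / 2 - √3 / 6)) * (1 - Real.cos (u + π / 3)) := by
  have hu := cos_sub_sin_le_one_sub h1 h2
  have e : √3 * √3 * Real.sin u = 3 * Real.sin u := by rw [Real.mul_self_sqrt (by norm_num)]
  rw [Real.cos_sub, Real.cos_add, Real.cos_pi_div_three, Real.sin_pi_div_three]
  linarith [hu, e]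

/-- **The weighted two-sided tangent bound** (contact `π/3`, weight `θ = ½ − √3/6` on the side
before the insertion): for `F ∈ [−π, π/3]`,
`½ + ½(F + π/3) ≤ θ(1 − cos F) + (1 − θ)(1 − cos(F + 2π/3))`. [folklore] -/
theorem weighted_one_sub_cos_ge {F : ℝ} (hF1 : -π ≤ F) (hF2 : F ≤ π / 3) :
    1 / 2 + 1 / 2 * (F + π / 3) ≤
      (1 / 2 - √3 / 6) * (1 - Real.cos F) + (1 - (1 / 2 - √3 / 6)) * (1 - Real.cos (F + 2 * π / 3)) := by
  have h := weighted_one_sub_cos_ge_aux (u := F + π / 3) (by linarith [Real.pi_pos])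
    (by linarith [Real.pi_pos])
  rw [show F + π / 3 - π / 3 = F by ring, show F + π / 3 + π / 3 = F + 2 * π / 3 by ring] at h
  exact h

/-- The mirror bound (weight `1 − θ` before the insertion): for `F ∈ [−π, π/3]`,
`½ − ½(F + π/3) ≤ (1 − θ)(1 − cos F) + θ(1 − cos(F + 2π/3))`. [folklore] -/
theorem weighted_one_sub_cos_ge_neg {F : ℝ} (hF1 : -π ≤ F) (hF2 : F ≤ π / 3) :
    1 / 2 - 1 / 2 * (F + π / 3) ≤
      (1 - (1 / 2 - √3 / 6)) * (1 - Real.cos F) + (1 / 2 - √3 / 6) * (1 - Real.cos (F + 2 * π / 3)) := by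
  have h := weighted_one_sub_cos_ge_aux (u := -(F + π / 3)) (by linarith [Real.pi_pos])
    (by linarith [Real.pi_pos])
  rw [show -(F + π / 3) - π / 3 = -(F + 2 * π / 3) by ring, show -(F + π / 3) + π / 3 = -F by ring,
    Real.cos_neg, Real.cos_neg] at h
  linarith [h]

/-- Summed weighted bound: `#s/2 + ½(Σ F + #s·π/3) ≤ θ Σ(1 − cos Fᵢ) + (1 − θ) Σ(1 − cos(Fᵢ + 2π/3))`
for `Fᵢ ∈ [−π, π/3]`. [folklore] -/
theorem weighted_tangent_le {ι : Type*} (s : Finset ι) (F : ι → ℝ)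
    (hF : ∀ i ∈ s, -π ≤ F i ∧ F i ≤ π / 3) :
    (s.card : ℝ) / 2 + 1 / 2 * (∑ i ∈ s, F i + s.card * (π / 3)) ≤
      (1 / 2 - √3 / 6) * ∑ i ∈ s, (1 - Real.cos (F i)) +
        (1 - (1 / 2 - √3 / 6)) * ∑ i ∈ s, (1 - Real.cos (F i + 2 * π / 3)) := by
  have e : (s.card : ℝ) / 2 + 1 / 2 * (∑ i ∈ s, F i + s.card * (π / 3)) =
      ∑ i ∈ s, (1 / 2 + 1 / 2 * (F i + π / 3)) := by
    rw [Finset.sum_add_distrib, Finset.sum_const, nsmul_eq_mul, ← Finset.mul_sum,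
      Finset.sum_add_distrib, Finset.sum_const, nsmul_eq_mul]
    ring
  rw [e, Finset.mul_sum, Finset.mul_sum, ← Finset.sum_add_distrib]
  exact Finset.sum_le_sum fun i hi => weighted_one_sub_cos_ge (hF i hi).1 (hF i hi).2

/-- Summed mirror bound: `#s/2 − ½(Σ F + #s·π/3) ≤ (1 − θ) Σ(1 − cos Fᵢ) + θ Σ(1 − cos(Fᵢ + 2π/3))`.
[folklore] -/
theorem weighted_tangent_le_neg {ι : Type*} (s : Finset ι) (F : ι → ℝ)
    (hF : ∀ i ∈ s, -π ≤ F i ∧ F i ≤ π / 3) :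
    (s.card : ℝ) / 2 - 1 / 2 * (∑ i ∈ s, F i + s.card * (π / 3)) ≤
      (1 - (1 / 2 - √3 / 6)) * ∑ i ∈ s, (1 - Real.cos (F i)) +
        (1 / 2 - √3 / 6) * ∑ i ∈ s, (1 - Real.cos (F i + 2 * π / 3)) := by
  have e : (s.card : ℝ) / 2 - 1 / 2 * (∑ i ∈ s, F i + s.card * (π / 3)) =
      ∑ i ∈ s, (1 / 2 - 1 / 2 * (F i + π / 3)) := by
    rw [Finset.sum_sub_distrib, Finset.sum_const, nsmul_eq_mul, ← Finset.mul_sum,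
      Finset.sum_add_distrib, Finset.sum_const, nsmul_eq_mul]
    ring
  rw [e, Finset.mul_sum, Finset.mul_sum, ← Finset.sum_add_distrib]
  exact Finset.sum_le_sum fun i hi => weighted_one_sub_cos_ge_neg (hF i hi).1 (hF i hi).2

/-- `max a b` dominates every convex combination. [folklore] -/
theorem convexComb_le_max {θ a b : ℝ} (h0 : 0 ≤ θ) (h1 : θ ≤ 1) :
    θ * a + (1 - θ) * b ≤ max a b := by
  nlinarith [le_max_left a b, le_max_right a b]

end Weighted

/-! ## §2 A wrap costs `3 + cos α` on the two sides together -/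

section Jump

variable {L : ℕ}

/-- `cos(G − b) + cos(G + b) = 2 cos G cos b`. [folklore] -/
theorem cos_sub_add_cos_add (G b : ℝ) :
    Real.cos (G - b) + Real.cos (G + b) = 2 * Real.cos G * Real.cos b := by
  rw [Real.cos_sub, Real.cos_add]; ring

/-- On `[π − b, π + b]` (`0 ≤ b ≤ π/2`) the cosine is at most `−cos b`. [folklore] -/
theorem cos_le_neg_cos_of_near_pi {G b : ℝ} (hb0 : 0 ≤ b) (hb : b ≤ π / 2) (h1 : π - b ≤ G)
    (h2 : G ≤ π + b) : Real.cos G ≤ -Real.cos b := by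
  rw [← Real.cos_pi_sub]
  rcases le_or_gt G π with hle | hgt
  · exact Real.cos_le_cos_of_nonneg_of_le_pi (by linarith) hle h1
  · rw [← Real.cos_neg G, ← Real.cos_add_two_pi (-G)]
    exact Real.cos_le_cos_of_nonneg_of_le_pi (by linarith) (by linarith) (by linarith)

/-- **Two-sided price of a wrap.**  If the insertion adds `a x ∈ [0, α]`, `α ≤ π`, at `x` and the
plaquette wraps (`F' = F + a x − 2π`), then `(1 − cos F) + (1 − cos F') ≥ 3 + cos α`. [folklore] -/
theorem three_add_cos_le_of_jump_mul {W U : GaugeConfig 2 L Circle} {a : Site 2 L → ℝ}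
    {x : Site 2 L} {α : ℝ} (ha0 : 0 ≤ a x) (hax : a x ≤ α) (hαπ : α ≤ π)
    (h : abelianFieldTensor (W * U) x 0 1 = abelianFieldTensor U x 0 1 + a x + 2 * π * (-1 : ℤ)) :
    3 + Real.cos α ≤ (1 - Real.cos (abelianFieldTensor U x 0 1)) +
      (1 - Real.cos (abelianFieldTensor (W * U) x 0 1)) := by
  have h1 : -π < abelianFieldTensor (W * U) x 0 1 := neg_pi_lt_abelianFieldTensor (W * U) x 0 1
  have h4 : abelianFieldTensor U x 0 1 ≤ π := abelianFieldTensor_le_pi U x 0 1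
  push_cast at h
  have hF' : Real.cos (abelianFieldTensor (W * U) x 0 1) =
      Real.cos (abelianFieldTensor U x 0 1 + a x) := by
    rw [h, show abelianFieldTensor U x 0 1 + a x + 2 * π * -1 =
      abelianFieldTensor U x 0 1 + a x - 2 * π by ring, Real.cos_sub_two_pi]
  have hsum := cos_sub_add_cos_add (abelianFieldTensor U x 0 1 + a x / 2) (a x / 2)
  rw [show abelianFieldTensor U x 0 1 + a x / 2 - a x / 2 = abelianFieldTensor U x 0 1 by ring,
    show abelianFieldTensor U x 0 1 + a x / 2 + a x / 2 = abelianFieldTensor U x 0 1 + a x by ring]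
    at hsum
  have hcos1 : Real.cos (abelianFieldTensor U x 0 1 + a x / 2) ≤ -Real.cos (a x / 2) :=
    cos_le_neg_cos_of_near_pi (by linarith) (by linarith) (by linarith) (by linarith)
  have hcos2 : 0 ≤ Real.cos (a x / 2) :=
    Real.cos_nonneg_of_mem_Icc ⟨by linarith [Real.pi_pos], by linarith⟩
  have hcos3 : Real.cos α ≤ Real.cos (a x) := Real.cos_le_cos_of_nonneg_of_le_pi ha0 hαπ hax
  have hcos4 : Real.cos (a x) = 2 * Real.cos (a x / 2) ^ 2 - 1 := by
    have hc := Real.cos_sq (a x / 2)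
    rw [show 2 * (a x / 2) = a x by ring] at hc
    linarith
  rw [hF']
  nlinarith [hsum, hcos1, hcos2, hcos3, hcos4, mul_le_mul_of_nonneg_right hcos1 hcos2]

end Jump

/-! ## §3 The mountain pass for three touched plaquettes -/

section Three

variable {L : ℕ} [NeZero L]

set_option maxHeartbeats 400000 in
/-- **THE MOUNTAIN-PASS INEQUALITY FOR THREE TOUCHED PLAQUETTES.**  Let the insertion `W` carry
plaquette angle `2π/3` on the `3` positions of `R` and `0` on the `6` positions of `Rᶜ`.  Then for
EVERY configuration `U` with `Q(WU) ≠ Q(U)`: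
`max(S(U), S(WU)) ≥ 3(1 − cos(π/3)) + 6(1 − cos(π/6))`. [folklore] -/
theorem threeSharpValue_le_max_wilsonAction_of_exp (W U : GaugeConfig 2 L Circle)
    (R : Finset (Site 2 L))
    (hW : ∀ x, plaquetteHolonomy W x 0 1 = Circle.exp (if x ∈ R then 2 * π / 3 else 0))
    (hN : R.card = 3) (hM : Rᶜ.card = 6)
    (hne : topCharge (0 : Site 2 L) 0 1 (W * U) ≠ topCharge (0 : Site 2 L) 0 1 U) :
    3 * (1 - Real.cos (π / 3)) + 6 * (1 - Real.cos (π / 6)) ≤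
      max (wilsonAction u1Rep U) (wilsonAction u1Rep (W * U)) := by
  classical
  have hπ := Real.pi_pos
  set α : ℝ := 2 * π / 3 with hα_def
  have hα0 : 0 < α := by positivity
  have hαπ : α < π := by rw [hα_def]; linarith
  set a : Site 2 L → ℝ := fun x => if x ∈ R then α else 0 with ha_def
  have hW' : ∀ x, plaquetteHolonomy W x 0 1 = Circle.exp (a x) := fun x => by
    rw [hW x]
  have ha : ∀ x, 0 ≤ a x ∧ a x < π := by
    intro x; simp only [ha_def]; split_ifs <;> constructor <;> linarith
  have haα : ∀ x, a x ≤ α := by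
    intro x; simp only [ha_def]; split_ifs <;> linarith
  have hj := fun x => exists_jump_mul W U a hW' ha x
  choose m hm01 hm using hj
  have hsuma : ∑ x : Site 2 L, a x = 2 * π := by
    rw [← Finset.sum_add_sum_compl R]
    rw [Finset.sum_congr rfl fun x (hx : x ∈ R) => show a x = α from if_pos hx,
      Finset.sum_eq_zero fun x (hx : x ∈ Rᶜ) => show a x = 0 from if_neg (Finset.mem_compl.mp hx),
      Finset.sum_const, nsmul_eq_mul, add_zero, hN, hα_def]
    push_cast
    ring
  have hQ := topCharge_mul_eq_of_jumps W U a m hm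
  rw [hsuma, div_self (by positivity : (2 : ℝ) * π ≠ 0)] at hQ
  -- the sum of the jumps is an integer `≠ -1`, each jump is `0` or `-1`
  have hsum_ne : (∑ x : Site 2 L, m x) ≠ -1 := by
    intro h
    have h' : (∑ x : Site 2 L, (m x : ℝ)) = -1 := by exact_mod_cast h
    rw [h'] at hQ
    exact hne (by rw [hQ]; ring)
  -- the sharp value is at most `5/2 = 3 + cos α`
  have hcos3 : Real.cos (π / 3) = 1 / 2 := Real.cos_pi_div_three
  have hcos6 : Real.cos (π / 6) = √3 / 2 := Real.cos_pi_div_six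
  have hcosα : Real.cos α = -(1 / 2) := by
    rw [hα_def, show 2 * π / 3 = π - π / 3 by ring, Real.cos_pi_sub, Real.cos_pi_div_three]
  have hs3 : (1.7 : ℝ) < √3 := by
    rw [Real.lt_sqrt (by norm_num)]; norm_num
  by_cases hall : ∀ x, m x = 0
  · -- no jump: the angles add
    have hF' : ∀ x : Site 2 L, abelianFieldTensor (W * U) x 0 1 =
        abelianFieldTensor U x 0 1 + a x := by
      intro x; rw [hm x, hall x]; simp
    set F : Site 2 L → ℝ := fun x => abelianFieldTensor U x 0 1 with hF
    have hFb : ∀ x, -π ≤ F x ∧ F x ≤ π :=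
      fun x => ⟨(neg_pi_lt_abelianFieldTensor U x 0 1).le, abelianFieldTensor_le_pi U x 0 1⟩
    -- on `R` the angle after insertion is still `≤ π`, so `F ≤ π/3` there
    have hFR : ∀ x ∈ R, -π ≤ F x ∧ F x ≤ π / 3 := by
      intro x hx
      refine ⟨(hFb x).1, ?_⟩
      have h2 := abelianFieldTensor_le_pi (W * U) x 0 1
      rw [hF', show a x = α from if_pos hx, hα_def] at h2
      show abelianFieldTensor U x 0 1 ≤ π / 3
      linarith
    -- the two actions, split over `R` and `Rᶜ`
    have hSU : wilsonAction u1Rep U =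
        ∑ x ∈ R, (1 - Real.cos (F x)) + ∑ x ∈ Rᶜ, (1 - Real.cos (F x)) := by
      rw [wilsonAction_eq_sum_site, ← Finset.sum_add_sum_compl R]
    have hSW : wilsonAction u1Rep (W * U) =
        ∑ x ∈ R, (1 - Real.cos (F x + 2 * π / 3)) + ∑ x ∈ Rᶜ, (1 - Real.cos (F x)) := by
      rw [wilsonAction_eq_sum_site, ← Finset.sum_add_sum_compl R]
      congr 1
      · refine Finset.sum_congr rfl fun x hx => ?_
        rw [hF', show a x = α from if_pos hx]
      · refine Finset.sum_congr rfl fun x hx => ?_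
        rw [hF', show a x = 0 from if_neg (Finset.mem_compl.mp hx), add_zero]
    -- flux quantisation
    obtain ⟨q, hq⟩ := exists_int_sum_site_eq U
    rw [← Finset.sum_add_sum_compl R] at hq
    set σ := ∑ x ∈ R, F x with hσ
    set τ := ∑ x ∈ Rᶜ, F x with hτ
    -- the weighted tangent bounds on `R`, the plain tangent bounds on `Rᶜ` at contact `π/6`
    have B1 := weighted_tangent_le R F hFR
    have B2 := weighted_tangent_le_neg R F hFR
    have hc2 : (0 : ℝ) ≤ π / 6 := by positivity
    have hc2' : π / 6 ≤ 7 / 10 := by linarith [Real.pi_lt_d2]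
    have B3 := sum_tangent_le Rᶜ F hc2 hc2' (fun x _ => hFb x)
    have B4 := sum_tangent_le_neg Rᶜ F hc2 hc2' (fun x _ => hFb x)
    rw [hN] at B1 B2
    rw [hM, Real.sin_pi_div_six] at B3 B4
    push_cast at B1 B2 B3 B4
    have hθ0 : (0 : ℝ) ≤ 1 / 2 - √3 / 6 := by
      have : √3 < 2 := by rw [Real.sqrt_lt' (by norm_num)]; norm_num
      linarith
    have hθ1 : 1 / 2 - √3 / 6 ≤ (1 : ℝ) := by linarith [Real.sqrt_nonneg 3]
    have hqZ : q ≤ -1 ∨ 0 ≤ q := by omega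
    rw [hSU, hSW, hcos3, hcos6]
    rcases hqZ with hq0 | hq0
    · -- `q ≤ -1`: the mirror combination, weight `1 − θ` before the insertion
      have hq' : (q : ℝ) ≤ -1 := by exact_mod_cast hq0
      have key := convexComb_le_max (a := ∑ x ∈ R, (1 - Real.cos (F x)) +
          ∑ x ∈ Rᶜ, (1 - Real.cos (F x)))
        (b := ∑ x ∈ R, (1 - Real.cos (F x + 2 * π / 3)) + ∑ x ∈ Rᶜ, (1 - Real.cos (F x)))
        (sub_nonneg.2 hθ1) (by linarith)
      have hπq : π * q ≤ -π := by nlinarith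
      nlinarith [key, B2, B4, hq, hπq]
    · -- `0 ≤ q`: weight `θ` before the insertion
      have hq' : (0 : ℝ) ≤ q := by exact_mod_cast hq0
      have key := convexComb_le_max (a := ∑ x ∈ R, (1 - Real.cos (F x)) +
          ∑ x ∈ Rᶜ, (1 - Real.cos (F x)))
        (b := ∑ x ∈ R, (1 - Real.cos (F x + 2 * π / 3)) + ∑ x ∈ Rᶜ, (1 - Real.cos (F x)))
        hθ0 hθ1
      have hπq : 0 ≤ π * q := by nlinarith
      nlinarith [key, B1, B3, hq, hπq]
  · -- a jump: at least two plaquettes wrap, each costs `3 + cos α = 5/2` on the two sides together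
    push Not at hall
    obtain ⟨x₀, hx₀⟩ := hall
    have hle0 : ∀ x, m x ≤ 0 := fun x => by rcases hm01 x with h | h <;> omega
    have hsum2 : (∑ x : Site 2 L, m x) ≤ -2 := by
      have hx₀' : m x₀ = -1 := (hm01 x₀).resolve_left hx₀
      have h1 : (∑ x : Site 2 L, m x) = m x₀ + ∑ x ∈ Finset.univ.erase x₀, m x :=
        (Finset.add_sum_erase Finset.univ m (Finset.mem_univ x₀)).symm
      have h2 : ∑ x ∈ Finset.univ.erase x₀, m x ≤ 0 := Finset.sum_nonpos fun x _ => hle0 x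
      omega
    have hterm : ∀ x : Site 2 L, -(m x : ℝ) * (3 + Real.cos α) ≤
        (1 - Real.cos (abelianFieldTensor U x 0 1)) +
          (1 - Real.cos (abelianFieldTensor (W * U) x 0 1)) := by
      intro x
      rcases hm01 x with h0 | h1
      · rw [h0, Int.cast_zero, neg_zero, zero_mul]
        linarith [Real.cos_le_one (abelianFieldTensor U x 0 1),
          Real.cos_le_one (abelianFieldTensor (W * U) x 0 1)]
      · have hx := hm x
        rw [h1] at hx
        rw [h1, Int.cast_neg, Int.cast_one, neg_neg, one_mul]
        exact three_add_cos_le_of_jump_mul (ha x).1 (haα x) hαπ.le hx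
    have hS : 2 * (3 + Real.cos α) ≤ wilsonAction u1Rep U + wilsonAction u1Rep (W * U) := by
      rw [wilsonAction_eq_sum_site, wilsonAction_eq_sum_site, ← Finset.sum_add_distrib]
      refine le_trans ?_ (Finset.sum_le_sum fun x _ => hterm x)
      rw [← Finset.sum_mul, Finset.sum_neg_distrib]
      have h2 : (2 : ℝ) ≤ -∑ x : Site 2 L, (m x : ℝ) := by
        have : ((∑ x : Site 2 L, m x : ℤ) : ℝ) ≤ -2 := by exact_mod_cast hsum2
        push_cast at this
        linarith
      have hc : 0 ≤ 3 + Real.cos α := by linarith [Real.neg_one_le_cos α]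
      exact mul_le_mul_of_nonneg_right h2 hc
    rw [hcosα] at hS
    rw [hcos3, hcos6]
    generalize wilsonAction u1Rep U = sU at hS ⊢
    generalize wilsonAction u1Rep (W * U) = sW at hS ⊢
    have hval : 3 * (1 - 1 / 2 : ℝ) + 6 * (1 - √3 / 2) ≤ 5 / 2 := by linarith only [hs3]
    rcases le_total sU sW with h | h
    · exact (le_max_right sU sW).trans' (by linarith only [hS, h, hval])
    · exact (le_max_left sU sW).trans' (by linarith only [hS, h, hval])

end Three

end Summit.Ventures.LatticeQCDFlow.Theory2.Lattice.Flux

end
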